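import Summits.HodgeConjecture.CorCM.MultiFieldWeilSurfaceBlockClosures
import HarnessLib

/-!
# MULTI-FIELD WEIL ENGINE — THE SEPARATION TEST FOR THREEFOLDS THROUGH IMAGINARY QUADRATIC FIELDS: `k_t ↪̸ K_{t′}` and `L_t ≠ L_{t′}`; hence ANY NUMBER of simple CM
# threefolds over sextic fields `K_t ⊇ k_t` with pairwise `k_t ↪̸ K_{t′}`, `L_t ≠ L_{t′}` (in groups of at most two), simple surfaces up to the dihedral-triple limit, any
# CM elliptic curves — the Hodge conjecture for every product of copies, given ONLY Markman's fourfold theorem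

Cell `pub-hodgecm2` (COR-CM), seat b30 gen 35 (2026-08-25); count-neutral own lane MULTI-FIELD WEIL ENGINE (stem `MultiFieldWeil*`), the user-facing corollary of
`CorCM/MultiFieldWeilSeparatedThreefoldBlocks.lean` ∕ `…SeparatedThreefoldPairsAnyCurves.lean` ∕ `…SurfaceBlockClosures.lean`.  Theorems only; no definition, no named fact,
no `sorry`.  HONEST FRAMING: §1 is UNCONDITIONAL field theory; §2 is conditional on the displayed Markman fourfold binder only; `HC_CM` is NOT proved and not asserted.

THE POINT.  The separation hypothesis of the previous files asks, for two sextic slots `t, t′` of different groups, that the Galois closures differ and that NO totally complex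
quadratic subfield of `K_t` embed in `K_{t′}`.  A sextic field has AT MOST ONE quadratic subfield (b16's `WeilFibre.nonempty_algEquiv_of_finrank_eq_two`, `4 ∤ 6`), so when
each threefold's field comes with an imaginary quadratic field `k_t ↪ K_t` (the engine's world: `K_t = k_t · F_t`) the test is simply **`k_t ↪̸ K_{t′}` and `L_t ≠ L_{t′}`**
(§1, `separated_of_quadratic`).  For `K_t = k·F`, `K_{t′} = k′·F′` this means: `k ≄ k′`, and not the «sister» configuration `L_F · k = L_{F′} · k′` (e.g. `F = F′` non-cyclic
and `k′ = ℚ(√(−d · disc F))`) — the one configuration where the two slots share the constituent `χ_k ⊗ std_F ≅ χ_{k′} ⊗ std_F` and must sit in one group.  §2 states the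
roofs: **`T_t ⊨ (K_t; Φ_t)` simple CM threefolds, `K_t ⊇ k_t` imaginary quadratic, grouped by `b` with at most two per group and `k_t ↪̸ K_{t′}`, `L_t ≠ L_{t′}` across groups;
simple CM surfaces no three of which (non-isogenous) share a Galois closure; any CM elliptic curves: the Hodge conjecture for every product of copies, GIVEN ONLY
`Markman2025_weilClasses_algebraic_abelianFourfold`** (`hodgeConjectureFor_prod_of_quadraticSeparated_threefoldPairs_of_markman`; pairwise version `…_pairwise_…`).  Compare
G10/G11/S4 (FOREIGN blocks: closure-composita meeting in a totally real field): here `k′ ⊂ L_t ∩ L_{t′}` is allowed.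

[cite: MoonenZarhin1999LowDim, Thm. (0.1), Thm. (0.2), §3 (3.1), Cor. (3.9), §5 (5.2)] [cite: Markman2025SurveySecant, Thm. 1.2] [cite: Gordon1999HodgeAVSurvey, §3 Theorem (proof), 7.4–7.7, 10.10]
[cite: Lang2002, VI §1 Thm. 1.1 and Cor. 1.6] [cite: Shimura1998, §8.2 Prop. 26, §8.4 (2)] [cite: MumfordAV1970, §19 Thm. 1 and p. 169]

## References
* [MoonenZarhin1999LowDim] B. Moonen, Yu. Zarhin, Math. Ann. 315 (1999) 711–733.  [Markman2025SurveySecant] E. Markman, arXiv:2509.23403, Thm. 1.2.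
  [Gordon1999HodgeAVSurvey] B. B. Gordon, *A survey of the Hodge conjecture for abelian varieties*, §3, 7.4–7.7, 10.10.  [Lang2002] S. Lang, *Algebra*, GTM 211, VI §1.
  [Shimura1998] G. Shimura, *Abelian varieties with complex multiplication and modular functions*, §8.2, §8.4.  [MumfordAV1970] D. Mumford, *Abelian Varieties*, §19.
-/

noncomputable section

open CategoryTheory CategoryTheory.Limits NumberField IntermediateField

namespace Summit.HodgeConjecture.CorCM.MultiFieldWeil

open Literature.AlgebraicGeometry Literature.AlgebraicGeometry.Motives Literature.AlgebraicGeometry.HodgeTheory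
open Literature.AlgebraicGeometry.ComplexMultiplication (IsCMTypeRealisation)
open Literature.AlgebraicTopology.SingularHomology
open Literature.NumberTheory.ComplexMultiplication
open Literature.AlgebraicGeometry.Pohlmann1968

open scoped Classical

section Family

variable {I : Type} {K : I → Type} [∀ i, Field (K i)] [∀ i, NumberField (K i)] [∀ i, IsCMField (K i)]
  {Φ : ∀ i, CMType (K i)} {A : I → AbelianVariety ℂ} {ι : ∀ i, 𝓞 (K i) →+* End (A i)} {θ : ∀ i, K i →+* Module.End ℂ (complexBetti (A i).X 1)}
  {C : Type} {kq : I → Type} [∀ i, Field (kq i)] [∀ i, NumberField (kq i)]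

/-! ## §1 The separation test -/

omit [∀ i, IsCMField (K i)] in
/-- **THE SEPARATION TEST.**  Sextic slots `t` equipped with imaginary quadratic fields `k_t ↪ K_t`; `b : I → C` a grouping such that across groups `k_t ↪̸ K_{t′}` and the
Galois closures differ.  Then differently grouped sextic slots are separated in the sense of `CorCM/MultiFieldWeilSeparatedThreefoldBlocks.lean`: no totally complex quadratic
subfield `F ≤ K_t` embeds in `K_{t′}` (such an `F` is isomorphic to `k_t`, a sextic field having at most one quadratic subfield; nothing is assumed on `k_t` beyond
`[k_t : ℚ] = 2` — a sextic CM field has no real quadratic subfield anyway). [cite: Lang2002, VI §1 Thm. 1.1 and Cor. 1.6] -/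
theorem separated_of_quadratic (b : I → C) (h2 : ∀ t, Module.finrank ℚ (K t) = 6 → Module.finrank ℚ (kq t) = 2)
    (e : ∀ t, Module.finrank ℚ (K t) = 6 → (kq t →+* K t))
    (hne : ∀ t t', Module.finrank ℚ (K t) = 6 → Module.finrank ℚ (K t') = 6 → b t ≠ b t' → normalClosure ℚ (K t) ℂ ≠ normalClosure ℚ (K t') ℂ ∧ IsEmpty (kq t →+* K t'))
    (t t' : I) (ht : Module.finrank ℚ (K t) = 6) (ht' : Module.finrank ℚ (K t') = 6) (hb : b t ≠ b t') :
    normalClosure ℚ (K t) ℂ ≠ normalClosure ℚ (K t') ℂ ∧ ¬ ∃ F : IntermediateField ℚ (K t), Module.finrank ℚ F = 2 ∧ IsTotallyComplex F ∧ Nonempty (F →+* K t') := by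
  obtain ⟨hL, hk⟩ := hne t t' ht ht' hb
  refine ⟨hL, ?_⟩
  rintro ⟨F, hF2, -, ⟨g⟩⟩
  obtain ⟨φ⟩ := WeilFibre.nonempty_algEquiv_of_finrank_eq_two (M := K t) (h2 t ht) hF2 (by rw [ht]; decide) (e t ht).toRatAlgHom F.val
  exact hk.false (g.comp φ.toRingEquiv.toRingHom)

/-! ## §2 The roofs -/

variable [Fintype I]

/-- **THREEFOLDS THROUGH IMAGINARY QUADRATIC FIELDS IN SEPARATED GROUPS OF AT MOST TWO, SURFACES UP TO THE DIHEDRAL-TRIPLE LIMIT, ANY CURVES, given ONLY Markman's fourfold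
theorem.**  `A_i ⊨ (K_i; Φ_i)` (`i ∈ I` finite) SIMPLE of dimension `≤ 3`; every sextic slot `t` carries an imaginary quadratic field `k_t ↪ K_t`; `b : I → C` a grouping with
at most two sextic slots per group and, across groups, `k_t ↪̸ K_{t′}` and different Galois closures; (iii′) among any three quartic slots with one Galois closure two carry
isogenous surfaces; any quadratic slots.  Then the Hodge conjecture holds for every product of copies `⨁_j A_{π j}`.  `HC_CM` is NOT asserted.
[cite: MoonenZarhin1999LowDim, Thm. (0.1), Thm. (0.2), §3 (3.1), Cor. (3.9)] [cite: Markman2025SurveySecant, Thm. 1.2] [cite: Gordon1999HodgeAVSurvey, §3 Theorem (proof), 7.5–7.7, 10.10] -/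
theorem hodgeConjectureFor_prod_of_quadraticSeparated_threefoldPairs_of_markman (hW4 : Markman2025_weilClasses_algebraic_abelianFourfold)
    (hA : ∀ i, IsCMTypeRealisation (Φ i) (A i) (ι i) (θ i)) (hS : ∀ i, (A i).IsSimple) (h3 : ∀ i, (A i).dim ≤ 3) (b : I → C)
    (h2 : ∀ t, Module.finrank ℚ (K t) = 6 → Module.finrank ℚ (kq t) = 2) (e : ∀ t, Module.finrank ℚ (K t) = 6 → (kq t →+* K t))
    (hne : ∀ t t', Module.finrank ℚ (K t) = 6 → Module.finrank ℚ (K t') = 6 → b t ≠ b t' → normalClosure ℚ (K t) ℂ ≠ normalClosure ℚ (K t') ℂ ∧ IsEmpty (kq t →+* K t'))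
    (hT2 : ∀ t t' t'' : I, Module.finrank ℚ (K t) = 6 → Module.finrank ℚ (K t') = 6 → Module.finrank ℚ (K t'') = 6 → b t = b t' → b t = b t'' →
      t = t' ∨ t = t'' ∨ t' = t'')
    (hS3 : ∀ i j l : I, Module.finrank ℚ (K i) = 4 → Module.finrank ℚ (K j) = 4 → Module.finrank ℚ (K l) = 4 →
      normalClosure ℚ (K i) ℂ = normalClosure ℚ (K j) ℂ → normalClosure ℚ (K j) ℂ = normalClosure ℚ (K l) ℂ →
      AbelianVariety.IsIsogenous (A i) (A j) ∨ AbelianVariety.IsIsogenous (A i) (A l) ∨ AbelianVariety.IsIsogenous (A j) (A l))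
    {N : ℕ} (π : Fin N → I) : HodgeConjectureFor (⨁ fun j => A (π j)).dim (⨁ fun j => A (π j)).X :=
  hodgeConjectureFor_prod_of_separatedThreefoldPairs_of_closures_of_markman hW4 hA hS h3 b (separated_of_quadratic b h2 e hne) hT2 hS3 π

/-- **Dominated form.** [cite: MoonenZarhin1999LowDim, Thm. (0.1), (0.2)] [cite: Markman2025SurveySecant, Thm. 1.2] [cite: MumfordAV1970, §19 Thm. 1 and p. 169] -/
theorem hodgeConjectureFor_of_avDominatedBy_prod_of_quadraticSeparated_threefoldPairs_of_markman (hW4 : Markman2025_weilClasses_algebraic_abelianFourfold)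
    (hA : ∀ i, IsCMTypeRealisation (Φ i) (A i) (ι i) (θ i)) (hS : ∀ i, (A i).IsSimple) (h3 : ∀ i, (A i).dim ≤ 3) (b : I → C)
    (h2 : ∀ t, Module.finrank ℚ (K t) = 6 → Module.finrank ℚ (kq t) = 2) (e : ∀ t, Module.finrank ℚ (K t) = 6 → (kq t →+* K t))
    (hne : ∀ t t', Module.finrank ℚ (K t) = 6 → Module.finrank ℚ (K t') = 6 → b t ≠ b t' → normalClosure ℚ (K t) ℂ ≠ normalClosure ℚ (K t') ℂ ∧ IsEmpty (kq t →+* K t'))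
    (hT2 : ∀ t t' t'' : I, Module.finrank ℚ (K t) = 6 → Module.finrank ℚ (K t') = 6 → Module.finrank ℚ (K t'') = 6 → b t = b t' → b t = b t'' →
      t = t' ∨ t = t'' ∨ t' = t'')
    (hS3 : ∀ i j l : I, Module.finrank ℚ (K i) = 4 → Module.finrank ℚ (K j) = 4 → Module.finrank ℚ (K l) = 4 →
      normalClosure ℚ (K i) ℂ = normalClosure ℚ (K j) ℂ → normalClosure ℚ (K j) ℂ = normalClosure ℚ (K l) ℂ →
      AbelianVariety.IsIsogenous (A i) (A j) ∨ AbelianVariety.IsIsogenous (A i) (A l) ∨ AbelianVariety.IsIsogenous (A j) (A l))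
    {N : ℕ} (π : Fin N → I) {X : AbelianVariety ℂ} (hX : Domination.AVDominatedBy X (⨁ fun j => A (π j))) : HodgeConjectureFor X.dim X.X :=
  Domination.hodgeConjectureFor_of_avDominatedBy
    (hodgeConjectureFor_prod_of_quadraticSeparated_threefoldPairs_of_markman hW4 hA hS h3 b h2 e hne hT2 hS3 π) hX

/-- **PAIRWISE version (`b = id`): ANY NUMBER of simple CM threefolds over sextic fields `K_t ⊇ k_t` with `k_t ↪̸ K_{t′}` and `L_t ≠ L_{t′}` for `t ≠ t′`, simple surfaces up
to the dihedral-triple limit, any CM elliptic curves — the Hodge conjecture for every product of copies, given ONLY Markman's fourfold theorem.**  (Each threefold with the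
curves through its field is its own block: gen 33's roof «a simple CM threefold × any CM elliptic curves» inside, the blocks split by the separation test.)  `HC_CM` is NOT
asserted. [cite: MoonenZarhin1999LowDim, Thm. (0.1), Thm. (0.2), §3 (3.1), Cor. (3.9)] [cite: Markman2025SurveySecant, Thm. 1.2] -/
theorem hodgeConjectureFor_prod_of_pairwise_quadraticSeparated_threefolds_of_markman (hW4 : Markman2025_weilClasses_algebraic_abelianFourfold)
    (hA : ∀ i, IsCMTypeRealisation (Φ i) (A i) (ι i) (θ i)) (hS : ∀ i, (A i).IsSimple) (h3 : ∀ i, (A i).dim ≤ 3)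
    (h2 : ∀ t, Module.finrank ℚ (K t) = 6 → Module.finrank ℚ (kq t) = 2) (e : ∀ t, Module.finrank ℚ (K t) = 6 → (kq t →+* K t))
    (hne : ∀ t t', Module.finrank ℚ (K t) = 6 → Module.finrank ℚ (K t') = 6 → t ≠ t' → normalClosure ℚ (K t) ℂ ≠ normalClosure ℚ (K t') ℂ ∧ IsEmpty (kq t →+* K t'))
    (hS3 : ∀ i j l : I, Module.finrank ℚ (K i) = 4 → Module.finrank ℚ (K j) = 4 → Module.finrank ℚ (K l) = 4 →
      normalClosure ℚ (K i) ℂ = normalClosure ℚ (K j) ℂ → normalClosure ℚ (K j) ℂ = normalClosure ℚ (K l) ℂ →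
      AbelianVariety.IsIsogenous (A i) (A j) ∨ AbelianVariety.IsIsogenous (A i) (A l) ∨ AbelianVariety.IsIsogenous (A j) (A l))
    {N : ℕ} (π : Fin N → I) : HodgeConjectureFor (⨁ fun j => A (π j)).dim (⨁ fun j => A (π j)).X :=
  hodgeConjectureFor_prod_of_quadraticSeparated_threefoldPairs_of_markman hW4 hA hS h3 id h2 e hne (fun _ _ _ _ _ _ h _ => Or.inl h) hS3 π

/-- **Dominated form** of the pairwise version. [cite: MoonenZarhin1999LowDim, Thm. (0.1), (0.2)] [cite: Markman2025SurveySecant, Thm. 1.2] [cite: MumfordAV1970, §19 Thm. 1 and p. 169] -/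
theorem hodgeConjectureFor_of_avDominatedBy_prod_of_pairwise_quadraticSeparated_threefolds_of_markman (hW4 : Markman2025_weilClasses_algebraic_abelianFourfold)
    (hA : ∀ i, IsCMTypeRealisation (Φ i) (A i) (ι i) (θ i)) (hS : ∀ i, (A i).IsSimple) (h3 : ∀ i, (A i).dim ≤ 3)
    (h2 : ∀ t, Module.finrank ℚ (K t) = 6 → Module.finrank ℚ (kq t) = 2) (e : ∀ t, Module.finrank ℚ (K t) = 6 → (kq t →+* K t))
    (hne : ∀ t t', Module.finrank ℚ (K t) = 6 → Module.finrank ℚ (K t') = 6 → t ≠ t' → normalClosure ℚ (K t) ℂ ≠ normalClosure ℚ (K t') ℂ ∧ IsEmpty (kq t →+* K t'))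
    (hS3 : ∀ i j l : I, Module.finrank ℚ (K i) = 4 → Module.finrank ℚ (K j) = 4 → Module.finrank ℚ (K l) = 4 →
      normalClosure ℚ (K i) ℂ = normalClosure ℚ (K j) ℂ → normalClosure ℚ (K j) ℂ = normalClosure ℚ (K l) ℂ →
      AbelianVariety.IsIsogenous (A i) (A j) ∨ AbelianVariety.IsIsogenous (A i) (A l) ∨ AbelianVariety.IsIsogenous (A j) (A l))
    {N : ℕ} (π : Fin N → I) {X : AbelianVariety ℂ} (hX : Domination.AVDominatedBy X (⨁ fun j => A (π j))) : HodgeConjectureFor X.dim X.X :=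
  Domination.hodgeConjectureFor_of_avDominatedBy (hodgeConjectureFor_prod_of_pairwise_quadraticSeparated_threefolds_of_markman hW4 hA hS h3 h2 e hne hS3 π) hX

end Family

end Summit.HodgeConjecture.CorCM.MultiFieldWeil

end
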